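import Literature.NumberTheory.Automorphic.HyperspecialUnitaryIwasawa
import Literature.NumberTheory.Automorphic.HyperspecialUnitaryIwasawaUnique
import HarnessLib

/-!
# Iwasawa decomposition of the quasi-split unitary group — III: the torus normal form `g = u · ϖ^a · k` and the
# bijection `{a : a ∘ rev = -a} ≃ U \ U(σ, J₀) / K₀` (Bruhat–Tits 1972 (4.4.3) (1))

Topic `NumberTheory/Automorphic`; namespace `Literature.NumberTheory.Automorphic.HermitianLattice` (lane `lit-hodgefound`,
Track 2 foundations; seat `lit-hodgefound-p11`, generation 36, row g36-#4).  THEOREMS ONLY (D-0026): no definition, no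
named fact, no instance, no notation.  Assembles `HyperspecialUnitaryIwasawa` (existence `U(σ, J₀) = B · K₀`) and
`HyperspecialUnitaryIwasawaUnique` (`B ∩ K₀` has unit diagonal; the Borel's diagonal lies in the torus) into the statement
AS PRINTED: `G = U · T · K₀` with the torus part unique modulo `T(𝒪)`.  Setting: `K` a field with `Valued K ℤᵐ⁰`,
`UnramifiedLocalConjDatum σ ϖ` (`σ` an involution preserving the valuation, `ϖ` a `σ`-fixed uniformiser — needed to have the
torus representatives `diag(ϖ^{a_i})` inside `U(σ, J₀)`), `U` = the upper UNItriangular elements of `U(σ, J₀)`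
(`(upperUnitriangular (Fin N) K).subgroupOf _`), `K₀ = unitaryInt σ (J₀.over K)`.

## The print

[BruhatTits1972] Prop. (4.4.3) (1) (held text `paper:doi-10-1007-bf02715544`, p0077 = p. 80): «On a `G = B̂⁰.V.K`
(« décomposition d'Iwasawa de `G` ») et l'application canonique de `V` dans `B̂⁰\G/K` est bijective.»  Here `V` = the
cocharacter group of the maximal split torus of `U(σ, J₀)`, i.e. `{a : Fin N → ℤ // a ∘ rev = -a}` acting through
`diag(ϖ^{a_i})`, `B̂⁰ ⊇ U` and `K = K₀`.  [Tits1979] §3.3.2; [Rogawski1990] §4.5 p. 45 («Iwasawa decomposition `G = BK`»);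
[CartierCorvallis1979] §IV (4.2) (the Satake transform integrates over `U` against the torus coordinate of `g = u t k`).

## What is formalised

* `diagonalGL_mem_unitaryGroupOfForm_of_norm` / `diagonalGL_mem_unitaryInt_of_norm` — the maximal torus
  `{diag(w) : σ(w_i) w_{rev i} = 1}` of `U(σ, J₀)` and its integral points `T(𝒪) ≤ K₀`.
* `mul_zpowDiagGL_apply_self`, `blockTriangular_mul_zpowDiagGL` — `u · diag(ϖ^a)` is upper triangular with diagonal `ϖ^{a_i}`.
* **`eq_of_unipotent_mul_zpowDiagGL_mul_unitaryInt_eq`** — `u ϖ^a k = u' ϖ^{a'} k'` (any `H`) forces `a = a'`.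
* **`UnramifiedLocalConjDatum.exists_eq_unipotent_mul_zpowDiagGL_mul_unitaryInt`** — THE TORUS NORMAL FORM: every
  `g ∈ U(σ, J₀)` is `u · diag(ϖ^{a_i}) · k`, `u` upper unitriangular in `U(σ, J₀)`, `a ∘ rev = -a`, `k ∈ K₀`;
  `UnramifiedLocalConjDatum.iwasawa_exponents_unique`.
* **`UnramifiedLocalConjDatum.bijective_doubleCosetMk_zpowDiagGL`** — BT (4.4.3) (1) for `U(σ, J₀)`: the map
  `{a // a ∘ rev = -a} → U \ U(σ, J₀) / K₀`, `a ↦ [diag(ϖ^a)]` (Mathlib `DoubleCoset.Quotient`), IS A BIJECTION.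

## References
* [BruhatTits1972] F. Bruhat, J. Tits, *Groupes réductifs sur un corps local I*, Publ. Math. IHÉS 41 (1972), (4.4.3).
* [Tits1979] J. Tits, *Reductive groups over local fields*, Proc. Symp. Pure Math. 33.1 (1979), §3.3.2.
* [Rogawski1990] J. D. Rogawski, *Automorphic Representations of Unitary Groups in Three Variables* (1990), §4.5 p. 45.
* [CartierCorvallis1979] P. Cartier, *Representations of 𝔭-adic groups: a survey*, PSPM 33.1 (1979), §IV (4.2).
-/

noncomputable section

open scoped Valued WithZero Matrix MatrixGroups

namespace Literature.NumberTheory.Automorphic.HermitianLattice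

open Literature.NumberTheory.Automorphic.CartanUnique Literature.NumberTheory.Automorphic.SymplecticCartan

variable {K : Type*} [Field K] {σ : K →+* K} {N : ℕ}

/-- A diagonal of units with `σ(w_i) w_{rev i} = 1` lies in `U(σ, J₀)` (the maximal torus; the `σ`-fixed case is
`diagonalGL_mem_unitaryGroupOfForm`). [cite: BruhatTits1972, (4.4.3)] [cite: Tits1979, §3.3.2] -/
theorem diagonalGL_mem_unitaryGroupOfForm_of_norm {w : Fin N → Kˣ} (hw : ∀ i, σ (w i) * w (Fin.rev i) = 1) :
    (diagonalGL (Fin N) K w : GL (Fin N) K) ∈ unitaryGroupOfForm σ ((StdForm.antidiagonal N).over K) := by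
  rw [mem_unitaryGroupOfForm_antidiagonal_iff]
  intro u v
  rw [coe_diagonalGL]
  exact B₀_diagonal_mulVec_of_norm hw u v

section Valued

variable [Valued K ℤᵐ⁰] {ϖ : K}

/-- A diagonal of `𝒪`-units with `σ(w_i) w_{rev i} = 1` lies in `K₀ = U(σ, J₀) ∩ GL_N(𝒪)` (the integral torus `T(𝒪)`).
[cite: BruhatTits1972, (4.4.3)] [cite: Tits1979, §3.3.2] -/
theorem diagonalGL_mem_unitaryInt_of_norm {w : Fin N → Kˣ} (hw : ∀ i, σ (w i) * w (Fin.rev i) = 1)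
    (hw1 : ∀ i, Valued.v (w i : K) = 1) :
    (⟨diagonalGL (Fin N) K w, diagonalGL_mem_unitaryGroupOfForm_of_norm hw⟩ :
        unitaryGroupOfForm σ ((StdForm.antidiagonal N).over K)) ∈ unitaryInt σ ((StdForm.antidiagonal N).over K) := by
  refine mem_unitaryInt_iff.2 ⟨fun i j => ?_, fun i j => ?_⟩
  · change Valued.v (((diagonalGL (Fin N) K w : GL (Fin N) K)) i j) ≤ 1
    rw [coe_diagonalGL, Matrix.diagonal_apply]
    split_ifs
    · rw [hw1]
    · rw [map_zero]; exact zero_le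
  · change Valued.v ((((diagonalGL (Fin N) K w : GL (Fin N) K))⁻¹ : GL (Fin N) K) i j) ≤ 1
    rw [← map_inv, coe_diagonalGL, Matrix.diagonal_apply]
    split_ifs
    · rw [Pi.inv_apply, Units.val_inv_eq_inv_val, map_inv₀, hw1, inv_one]
    · rw [map_zero]; exact zero_le

omit [Valued K ℤᵐ⁰] in
/-- The product `u · diag(ϖ^a)` of an upper unitriangular `u` and a torus element is upper triangular with diagonal
`ϖ^{a_i}`. [cite: BruhatTits1972, (4.4.3)] -/
theorem mul_zpowDiagGL_apply_self {u : GL (Fin N) K} (hu : u ∈ upperUnitriangular (Fin N) K) (hϖ0 : ϖ ≠ 0)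
    (a : Fin N → ℤ) (i : Fin N) :
    ((u * zpowDiagGL hϖ0 a : GL (Fin N) K) : Matrix (Fin N) (Fin N) K) i i = ϖ ^ a i := by
  obtain ⟨hut, hud⟩ := (mem_upperUnitriangular_iff u).1 hu
  rw [Units.val_mul, Matrix.BlockTriangular.mul_apply_self hut (blockTriangular_zpowDiagGL hϖ0 a) i, hud i, one_mul,
    coe_zpowDiagGL, Matrix.diagonal_apply_eq]

omit [Valued K ℤᵐ⁰] in
/-- `u · diag(ϖ^a)` is upper triangular for `u` upper unitriangular. [cite: BruhatTits1972, (4.4.3)] -/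
theorem blockTriangular_mul_zpowDiagGL {u : GL (Fin N) K} (hu : u ∈ upperUnitriangular (Fin N) K) (hϖ0 : ϖ ≠ 0)
    (a : Fin N → ℤ) : ((u * zpowDiagGL hϖ0 a : GL (Fin N) K) : Matrix (Fin N) (Fin N) K).BlockTriangular id := by
  rw [Units.val_mul]
  exact ((mem_upperUnitriangular_iff u).1 hu).1.mul (blockTriangular_zpowDiagGL hϖ0 a)

/-- **UNIQUENESS OF THE IWASAWA EXPONENTS**: if `u ϖ^a k = u' ϖ^{a'} k'` in `U(σ, H)` with `u, u'` upper unitriangular and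
`k, k' ∈ K₀ = U(σ, H) ∩ GL_N(𝒪)`, then `a = a'` (`v_apply_self_eq_of_upper_mul_unitaryInt_eq` on `b = u ϖ^a`, `b' = u' ϖ^{a'}`,
whose diagonals are `ϖ^{a_i}`, `ϖ^{a'_i}`). [cite: BruhatTits1972, (4.4.3)] [cite: Tits1979, §3.3.2] -/
theorem eq_of_unipotent_mul_zpowDiagGL_mul_unitaryInt_eq (hϖ : Valued.v ϖ = WithZero.exp (-1 : ℤ))
    {H : Matrix (Fin N) (Fin N) K} {u u' t t' k k' : unitaryGroupOfForm σ H}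
    (hu : (u : GL (Fin N) K) ∈ upperUnitriangular (Fin N) K) (hu' : (u' : GL (Fin N) K) ∈ upperUnitriangular (Fin N) K)
    {a a' : Fin N → ℤ} (ht : (t : GL (Fin N) K) = zpowDiagGL (uniformizer_ne_zero hϖ) a)
    (ht' : (t' : GL (Fin N) K) = zpowDiagGL (uniformizer_ne_zero hϖ) a')
    (hk : k ∈ unitaryInt σ H) (hk' : k' ∈ unitaryInt σ H) (h : u * t * k = u' * t' * k') : a = a' := by
  have hϖ0 := uniformizer_ne_zero hϖ
  have hb : (((u * t : unitaryGroupOfForm σ H) : GL (Fin N) K) : Matrix (Fin N) (Fin N) K).BlockTriangular id := by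
    rw [Subgroup.coe_mul, ht]; exact blockTriangular_mul_zpowDiagGL hu hϖ0 a
  have hb' : (((u' * t' : unitaryGroupOfForm σ H) : GL (Fin N) K) : Matrix (Fin N) (Fin N) K).BlockTriangular id := by
    rw [Subgroup.coe_mul, ht']; exact blockTriangular_mul_zpowDiagGL hu' hϖ0 a'
  funext i
  have h1 := v_apply_self_eq_of_upper_mul_unitaryInt_eq hb hb' hk hk' h i
  rw [Subgroup.coe_mul, Subgroup.coe_mul, ht, ht', mul_zpowDiagGL_apply_self hu hϖ0, mul_zpowDiagGL_apply_self hu' hϖ0,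
    v_uniformizer_zpow hϖ, v_uniformizer_zpow hϖ, WithZero.exp_inj] at h1
  omega

/-- **THE TORUS NORMAL FORM `g = u · ϖ^a · k` of the Iwasawa decomposition** (under `UnramifiedLocalConjDatum σ ϖ`: `σ` an
involution preserving the valuation and `ϖ` a `σ`-FIXED uniformiser): every `g ∈ U(σ, J₀)` is `u · diag(ϖ^{a_i}) · k` with
`u ∈ U(σ, J₀)` upper unitriangular, `a ∘ rev = -a` (a cocharacter of the maximal split torus) and `k ∈ K₀`.  From `g = b k₀`
(`exists_eq_upper_mul_unitaryInt`): the diagonal `d` of `b` satisfies `σ(d_i) d_{rev i} = 1`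
(`map_apply_self_mul_apply_rev_of_blockTriangular`), so `d_i = ϖ^{a_i} w_i` with `a_{rev i} = -a_i` and `diag(w) ∈ T(𝒪) ≤ K₀`,
and `b = (b diag(d)⁻¹) · diag(ϖ^a) · diag(w)`. [cite: BruhatTits1972, (4.4.3)] [cite: Tits1979, §3.3.2] [cite: Rogawski1990, §4.5 p. 45] -/
theorem UnramifiedLocalConjDatum.exists_eq_unipotent_mul_zpowDiagGL_mul_unitaryInt (hd : UnramifiedLocalConjDatum σ ϖ)
    (g : unitaryGroupOfForm σ ((StdForm.antidiagonal N).over K)) :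
    ∃ (u t k : unitaryGroupOfForm σ ((StdForm.antidiagonal N).over K)) (a : Fin N → ℤ),
      (u : GL (Fin N) K) ∈ upperUnitriangular (Fin N) K ∧ (∀ i, a (Fin.rev i) = -a i) ∧
      (t : GL (Fin N) K) = zpowDiagGL (uniformizer_ne_zero hd.vϖ) a ∧
      k ∈ unitaryInt σ ((StdForm.antidiagonal N).over K) ∧ g = u * t * k := by
  have hϖ := hd.vϖ
  have hϖ0 := uniformizer_ne_zero hϖ
  obtain ⟨b, k₀, hk₀, hb, hgb⟩ := hd.exists_eq_upper_mul_unitaryInt g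
  -- the diagonal `d` of `b`, its exponents and unit parts
  obtain ⟨d, hd_def⟩ : ∃ d : Fin N → K, d = fun i => ((b : GL (Fin N) K) : Matrix (Fin N) (Fin N) K) i i := ⟨_, rfl⟩
  have hd0 : ∀ i, d i ≠ 0 := fun i => by rw [hd_def]; exact apply_self_ne_zero_of_blockTriangular _ hb i
  have hdd : ∀ i, σ (d i) * d (Fin.rev i) = 1 := fun i => by
    rw [hd_def]; exact map_apply_self_mul_apply_rev_of_blockTriangular _ b.2 hb i
  choose e he using fun i => exists_v_eq_exp (hd0 i)
  have herev : ∀ i, e (Fin.rev i) = -e i := fun i => by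
    have h1 := congrArg Valued.v (hdd i)
    rw [map_mul, hd.vσ, map_one, he, he, ← WithZero.exp_add, ← WithZero.exp_zero, WithZero.exp_inj] at h1
    omega
  obtain ⟨a, ha_def⟩ : ∃ a : Fin N → ℤ, a = fun i => -e i := ⟨_, rfl⟩
  have ha : ∀ i, a (Fin.rev i) = -a i := fun i => by rw [ha_def]; dsimp only; rw [herev, neg_neg]
  have hw1 : ∀ i, Valued.v (d i * ϖ ^ e i) = 1 := fun i => v_mul_zpow_eq_one_of_v_eq_exp hϖ (he i)
  obtain ⟨w, hw_def⟩ : ∃ w : Fin N → Kˣ, w = fun i => Units.mk0 (d i * ϖ ^ e i) (ne_zero_of_v_eq_one (hw1 i)) :=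
    ⟨_, rfl⟩
  have hwval : ∀ i, (w i : K) = d i * ϖ ^ e i := fun i => by rw [hw_def]; rfl
  have hw1' : ∀ i, Valued.v (w i : K) = 1 := fun i => by rw [hwval]; exact hw1 i
  have hwnorm : ∀ i, σ (w i) * w (Fin.rev i) = 1 := fun i => by
    rw [hwval, hwval, map_mul, map_zpow₀, hd.σϖ, herev, mul_mul_mul_comm, hdd, one_mul, ← zpow_add₀ hϖ0,
      add_neg_cancel, zpow_zero]
  have hdaw : ∀ i, d i = ϖ ^ a i * w i := fun i => by
    rw [hwval, ha_def]
    dsimp only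
    rw [mul_left_comm, ← zpow_add₀ hϖ0, neg_add_cancel, zpow_zero, mul_one]
  -- the three torus elements `D = diag(d)`, `Z = diag(ϖ^a)`, `W = diag(w)` inside `U(σ, J₀)`
  set Z : unitaryGroupOfForm σ ((StdForm.antidiagonal N).over K) :=
    ⟨zpowDiagGL hϖ0 a, zpowDiagGL_mem_unitaryGroupOfForm hd.σϖ hϖ0 ha⟩ with hZ
  set W : unitaryGroupOfForm σ ((StdForm.antidiagonal N).over K) :=
    ⟨diagonalGL (Fin N) K w, diagonalGL_mem_unitaryGroupOfForm_of_norm hwnorm⟩ with hW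
  have hWK : W ∈ unitaryInt σ ((StdForm.antidiagonal N).over K) := diagonalGL_mem_unitaryInt_of_norm hwnorm hw1'
  -- `diagPart b = d` and `diagonalGL (diagPart b) = Z * W` in `GL_N`
  have hdiag : diagonalGL (Fin N) K (diagPart (b : GL (Fin N) K) hb) = zpowDiagGL hϖ0 a * diagonalGL (Fin N) K w := by
    refine Units.ext ?_
    rw [coe_diagonalGL, Units.val_mul, coe_zpowDiagGL, coe_diagonalGL, Matrix.diagonal_mul_diagonal]
    congr 1
    funext i
    rw [coe_diagPart, ← hdaw i, hd_def]
  -- the unipotent part `u = b · diag(d)⁻¹`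
  have huU : (b : GL (Fin N) K) * (diagonalGL (Fin N) K (diagPart (b : GL (Fin N) K) hb))⁻¹ ∈
      upperUnitriangular (Fin N) K := mul_diagonalGL_inv_mem_upperUnitriangular _ hb
  set u : unitaryGroupOfForm σ ((StdForm.antidiagonal N).over K) := b * (Z * W)⁻¹ with hu_def
  have hucoe : (u : GL (Fin N) K) = (b : GL (Fin N) K) * (diagonalGL (Fin N) K (diagPart (b : GL (Fin N) K) hb))⁻¹ := by
    rw [hu_def, Subgroup.coe_mul, Subgroup.coe_inv, Subgroup.coe_mul, hdiag]
  refine ⟨u, Z, W * k₀, a, by rw [hucoe]; exact huU, ha, rfl, (unitaryInt σ _).mul_mem hWK hk₀, ?_⟩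
  rw [hgb, hu_def]
  group

/-- **The Iwasawa exponents of `g` are well defined**: two normal forms `g = u ϖ^a k = u' ϖ^{a'} k'` have `a = a'`.
[cite: BruhatTits1972, (4.4.3)] -/
theorem UnramifiedLocalConjDatum.iwasawa_exponents_unique (hd : UnramifiedLocalConjDatum σ ϖ)
    {g u u' t t' k k' : unitaryGroupOfForm σ ((StdForm.antidiagonal N).over K)} {a a' : Fin N → ℤ}
    (hu : (u : GL (Fin N) K) ∈ upperUnitriangular (Fin N) K) (hu' : (u' : GL (Fin N) K) ∈ upperUnitriangular (Fin N) K)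
    (ht : (t : GL (Fin N) K) = zpowDiagGL (uniformizer_ne_zero hd.vϖ) a)
    (ht' : (t' : GL (Fin N) K) = zpowDiagGL (uniformizer_ne_zero hd.vϖ) a')
    (hk : k ∈ unitaryInt σ ((StdForm.antidiagonal N).over K)) (hk' : k' ∈ unitaryInt σ ((StdForm.antidiagonal N).over K))
    (hg : g = u * t * k) (hg' : g = u' * t' * k') : a = a' :=
  eq_of_unipotent_mul_zpowDiagGL_mul_unitaryInt_eq hd.vϖ hu hu' ht ht' hk hk' (hg ▸ hg' ▸ rfl)

/-- **BRUHAT–TITS (4.4.3) (1) for `U(σ, J₀)`: the map `a ↦ U · diag(ϖ^a) · K₀` from the cocharacters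
`{a : Fin N → ℤ // a ∘ rev = -a}` to the double cosets `U \ U(σ, J₀) / K₀` (`U` = upper unitriangular elements of
`U(σ, J₀)`, `K₀ = U(σ, J₀) ∩ GL_N(𝒪)`) IS A BIJECTION** («l'application canonique de `V` dans `B̂⁰\G/K` est bijective»).
[cite: BruhatTits1972, (4.4.3)] [cite: Tits1979, §3.3.2] -/
theorem UnramifiedLocalConjDatum.bijective_doubleCosetMk_zpowDiagGL (hd : UnramifiedLocalConjDatum σ ϖ) :
    Function.Bijective fun a : {a : Fin N → ℤ // ∀ i, a (Fin.rev i) = -a i} =>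
      DoubleCoset.mk ((upperUnitriangular (Fin N) K).subgroupOf (unitaryGroupOfForm σ ((StdForm.antidiagonal N).over K)))
        (unitaryInt σ ((StdForm.antidiagonal N).over K))
        (⟨zpowDiagGL (uniformizer_ne_zero hd.vϖ) a.1, zpowDiagGL_mem_unitaryGroupOfForm hd.σϖ _ a.2⟩ :
          unitaryGroupOfForm σ ((StdForm.antidiagonal N).over K)) := by
  have hϖ := hd.vϖ
  constructor
  · rintro ⟨a, ha⟩ ⟨a', ha'⟩ h
    obtain ⟨u, hu, k, hk, huk⟩ := (DoubleCoset.eq _ _ _ _).1 h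
    rw [Subgroup.mem_subgroupOf] at hu
    -- `ϖ^{a'} = u ϖ^a k`, i.e. `1 · ϖ^{a'} · 1 = u · ϖ^a · k`
    have h1 : (1 : unitaryGroupOfForm σ ((StdForm.antidiagonal N).over K)) *
        ⟨zpowDiagGL (uniformizer_ne_zero hϖ) a', zpowDiagGL_mem_unitaryGroupOfForm hd.σϖ _ ha'⟩ * 1 =
        u * ⟨zpowDiagGL (uniformizer_ne_zero hϖ) a, zpowDiagGL_mem_unitaryGroupOfForm hd.σϖ _ ha⟩ * k := by
      rw [one_mul, mul_one]; exact huk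
    have h2 := eq_of_unipotent_mul_zpowDiagGL_mul_unitaryInt_eq hϖ (Subgroup.one_mem _) hu rfl rfl
      (Subgroup.one_mem _) hk h1
    exact Subtype.ext h2.symm
  · intro q
    induction q using Quotient.inductionOn with
    | h g =>
      obtain ⟨u, t, k, a, hu, ha, ht, hk, hg⟩ := hd.exists_eq_unipotent_mul_zpowDiagGL_mul_unitaryInt g
      refine ⟨⟨a, ha⟩, ?_⟩
      change DoubleCoset.mk _ _ _ = DoubleCoset.mk _ _ g
      rw [DoubleCoset.eq]
      refine ⟨u, Subgroup.mem_subgroupOf.2 hu, k, hk, ?_⟩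
      rw [hg]
      congr 2
      exact Subtype.ext ht

end Valued

end Literature.NumberTheory.Automorphic.HermitianLattice

end
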